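import Mathlib
import Literature.RingTheory.Smooth.AugmentationIdealCotangentBaseChange
import HarnessLib

/-!
# The Zariski cotangent space at a rational point of a standard smooth algebra

Let `K` be a field and `A` a `K`-algebra which is standard smooth of relative dimension `n`
(`Algebra.IsStandardSmoothOfRelativeDimension n K A`), and let `e : A →ₐ[K] K` be a `K`-rational
point with maximal ideal `𝔪 = ker e`.  Then the Zariski cotangent space `𝔪 / 𝔪²`
(`(RingHom.ker e).Cotangent`) is a finite-dimensional `K`-vector space of dimension `n`.

Proof: the conormal map `𝔪/𝔪² → K ⊗[A] Ω[A⁄K]` (`KaehlerDifferential.kerCotangentToTensor`) is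
injective because `A` is formally smooth over `K` and `H¹(L_{K/K}) = 0`
(`Algebra.FormallySmooth.kerCotangentToTensor_injective_iff`), and surjective because
`Ω[K⁄K] = 0` (`KaehlerDifferential.range_kerCotangentToTensor`); and `Ω[A⁄K]` is free of rank `n`
(`Algebra.IsStandardSmoothOfRelativeDimension.rank_kaehlerDifferential`).

## References

* A. Grothendieck, *EGA IV₄*, Publ. Math. IHÉS 32 (1967), Prop. 17.5.3 / Cor. 17.15.9. [Grothendieck1967]
* The Stacks Project, Tag 00TA, Tag 031I. [StacksProject]
-/

noncomputable section

open TensorProduct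

namespace Literature.RingTheory.Smooth

universe u v

variable {K : Type u} {A : Type v} [Field K] [CommRing A] [Algebra K A]

/-- For the `A`-algebra structure on `K` given by a rational point `e : A →ₐ[K] K`, the tower
`K → A → K` is a scalar tower (plumbing). [folklore] -/
private theorem isScalarTower_point (e : A →ₐ[K] K) :
    letI := e.toRingHom.toAlgebra; IsScalarTower K A K := by
  letI := e.toRingHom.toAlgebra
  exact IsScalarTower.of_algebraMap_eq fun c ↦ by
    simp [RingHom.algebraMap_toAlgebra]

/-- For a `K`-rational point `e` of a formally smooth `K`-algebra `A`, the conormal map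
`𝔪/𝔪² → K ⊗[A] Ω[A⁄K]` of `𝔪 = ker e` (for the `A`-algebra structure `e` on `K`, under which
`RingHom.ker (algebraMap A K)` is the tree's `augIdeal e`) is bijective.
[cite: Grothendieck1967, IV₄ Prop. 17.2.5; StacksProject, Tag 031I] -/
theorem kerCotangentToTensor_bijective_of_formallySmooth [Algebra.FormallySmooth K A]
    (e : A →ₐ[K] K) :
    letI := e.toRingHom.toAlgebra
    Function.Bijective (KaehlerDifferential.kerCotangentToTensor K A K) := by
  letI := e.toRingHom.toAlgebra
  haveI := isScalarTower_point e
  have hsurj : Function.Surjective (algebraMap A K) := fun c ↦ ⟨algebraMap K A c, e.commutes c⟩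
  refine ⟨?_, ?_⟩
  · exact (Algebra.FormallySmooth.kerCotangentToTensor_injective_iff hsurj).2 inferInstance
  · rw [← LinearMap.range_eq_top, KaehlerDifferential.range_kerCotangentToTensor K A K hsurj]
    ext x
    simp only [Submodule.restrictScalars_mem, LinearMap.mem_ker, Submodule.mem_top, iff_true]
    exact Subsingleton.elim _ _

/-- For a `K`-rational point `e` of a formally smooth `K`-algebra `A`, the Zariski cotangent
space `𝔪/𝔪²` of `𝔪 = ker e = augIdeal e` is `K`-linearly isomorphic to `K ⊗[A] Ω[A⁄K]`.
[cite: Grothendieck1967, IV₄ Prop. 17.2.5] -/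
theorem nonempty_cotangent_linearEquiv_tensor_kaehlerDifferential [Algebra.FormallySmooth K A]
    (e : A →ₐ[K] K) :
    letI := e.toRingHom.toAlgebra
    Nonempty ((augIdeal e).Cotangent ≃ₗ[K] K ⊗[A] Ω[A⁄K]) := by
  letI := e.toRingHom.toAlgebra
  haveI := isScalarTower_point e
  exact ⟨(LinearEquiv.ofBijective _
    (kerCotangentToTensor_bijective_of_formallySmooth e)).restrictScalars K⟩

/-- The Zariski cotangent space at a rational point of a standard smooth algebra of relative
dimension `n` is finite-dimensional. [cite: Grothendieck1967, IV₄ Cor. 17.15.9] -/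
theorem finite_cotangent_ker {n : ℕ} [Algebra.IsStandardSmoothOfRelativeDimension n K A]
    (e : A →ₐ[K] K) : Module.Finite K (augIdeal e).Cotangent := by
  letI := e.toRingHom.toAlgebra
  haveI := isScalarTower_point e
  haveI : Algebra.IsStandardSmooth K A :=
    Algebra.IsStandardSmoothOfRelativeDimension.isStandardSmooth n
  obtain ⟨ε⟩ := nonempty_cotangent_linearEquiv_tensor_kaehlerDifferential e
  exact Module.Finite.equiv ε.symm

/-- **Dimension of the cotangent space.** At a `K`-rational point of a standard smooth
`K`-algebra of relative dimension `n`, `dim_K 𝔪/𝔪² = n`.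
[cite: Grothendieck1967, IV₄ Prop. 17.5.3, Cor. 17.15.9; StacksProject, Tag 00TA] -/
theorem finrank_cotangent_ker_eq {n : ℕ} [Algebra.IsStandardSmoothOfRelativeDimension n K A]
    (e : A →ₐ[K] K) : Module.finrank K (augIdeal e).Cotangent = n := by
  letI := e.toRingHom.toAlgebra
  haveI := isScalarTower_point e
  haveI : Algebra.IsStandardSmooth K A :=
    Algebra.IsStandardSmoothOfRelativeDimension.isStandardSmooth n
  haveI : Nontrivial A := e.toRingHom.domain_nontrivial
  obtain ⟨ε⟩ := nonempty_cotangent_linearEquiv_tensor_kaehlerDifferential e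
  rw [ε.finrank_eq, Module.finrank_baseChange]
  exact Module.finrank_eq_of_rank_eq
    (Algebra.IsStandardSmoothOfRelativeDimension.rank_kaehlerDifferential n)

/-- **Interface form.** Let `e : A →ₐ[K] K` be a rational point of a standard smooth `K`-algebra
of relative dimension `n`, `𝔪 = ker e`, and let `L : 𝔪 →ₗ[K] W` be a `K`-linear map which kills
`𝔪²` and maps ONTO a `K`-vector space `W` of dimension `n`.  Then `ker L = 𝔪²`: an element of `𝔪`
with `L x = 0` lies in `𝔪²` (because `L` factors through the `n`-dimensional `𝔪/𝔪²`, where it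
is surjective, hence injective). [cite: Grothendieck1967, IV₄ Cor. 17.15.9] -/
theorem mem_sq_of_apply_eq_zero {n : ℕ} [Algebra.IsStandardSmoothOfRelativeDimension n K A]
    (e : A →ₐ[K] K) {W : Type*} [AddCommGroup W] [Module K W] [FiniteDimensional K W]
    (hW : Module.finrank K W = n) (L : ↥(augIdeal e) →ₗ[K] W)
    (hL2 : ∀ x : ↥(augIdeal e), (x : A) ∈ augIdeal e ^ 2 → L x = 0)
    (hL : Function.Surjective L) {x : ↥(augIdeal e)} (hx : L x = 0) :
    (x : A) ∈ augIdeal e ^ 2 := by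
  -- `augIdeal e` is (definitionally) the kernel of the structure map of the point algebra
  haveI hfin : Module.Finite K (augIdeal e).Cotangent := finite_cotangent_ker (n := n) e
  have hrk : Module.finrank K (augIdeal e).Cotangent = n := finrank_cotangent_ker_eq (n := n) e
  -- `L` factors through `(augIdeal e).toCotangent`
  have hkerle : LinearMap.ker ((augIdeal e).toCotangent.restrictScalars K) ≤ LinearMap.ker L := by
    intro y hy
    rw [LinearMap.mem_ker, LinearMap.restrictScalars_apply, Ideal.toCotangent_eq_zero] at hy
    exact LinearMap.mem_ker.2 (hL2 y hy)
  obtain ⟨Lbar, hLbar⟩ : ∃ Lbar : (augIdeal e).Cotangent →ₗ[K] W, Lbar ∘ₗ (augIdeal e).toCotangent.restrictScalars K = L := by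
    refine ⟨(LinearMap.ker ((augIdeal e).toCotangent.restrictScalars K)).liftQ L hkerle ∘ₗ
      (LinearMap.quotKerEquivOfSurjective ((augIdeal e).toCotangent.restrictScalars K)
        (Ideal.toCotangent_surjective (augIdeal e))).symm.toLinearMap, ?_⟩
    ext y
    simp only [LinearMap.coe_comp, LinearEquiv.coe_coe, Function.comp_apply]
    have : (LinearMap.quotKerEquivOfSurjective ((augIdeal e).toCotangent.restrictScalars K)
        (Ideal.toCotangent_surjective (augIdeal e))).symm ((augIdeal e).toCotangent.restrictScalars K y) =
        Submodule.Quotient.mk y := by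
      rw [LinearEquiv.symm_apply_eq]
      rfl
    rw [this, Submodule.liftQ_apply]
  have hLbar_surj : Function.Surjective Lbar := by
    intro w
    obtain ⟨y, rfl⟩ := hL w
    exact ⟨(augIdeal e).toCotangent y, by rw [← hLbar]; rfl⟩
  have hLbar_inj : Function.Injective Lbar := by
    have h1 : Module.finrank K (augIdeal e).Cotangent = Module.finrank K W := by rw [hrk, hW]
    exact (LinearMap.injective_iff_surjective_of_finrank_eq_finrank h1).2 hLbar_surj
  have hx' : Lbar ((augIdeal e).toCotangent x) = 0 := by
    have := congrArg (fun f => f x) hLbar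
    simp only [LinearMap.coe_comp, Function.comp_apply, LinearMap.restrictScalars_apply] at this
    rw [this]; exact hx
  have : (augIdeal e).toCotangent x = 0 := hLbar_inj (by rw [hx', map_zero])
  exact (Ideal.toCotangent_eq_zero (augIdeal e) x).1 this

end Literature.RingTheory.Smooth
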